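import Summits.CriticalPhenomena.PercolationContinuityZ3.Theorems.PercNearOneGluingNoHeavyPcintMemUniformChunk
import Summits.CriticalPhenomena.PercolationContinuityZ3.Theorems.PercNearOneGluingNoHeavyPcintMemUniformPolyCert
import Summits.CriticalPhenomena.PercolationContinuityZ3.Theorems.PercNearOneGluingNoHeavyPcintClosingCountKernel
import HarnessLib

/-!
# CriticalPhenomena/PercolationContinuityZ3 — Theorems/PercNearOneGluingNoHeavyPcintMemUniformChunkCert.lean: polynomial certificates and exact-count stages on CHUNKED row lists (base dimension 6), with their soundness

Lane prim-pcint, STRUCTURE rule (prim-pcint-2 GEN 19).  The `k = 5` analogues of …PcintMemUniformPolyCert (`UPolyCert5`) and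
…PcintMemUniformPolyCount (`stageOK5`), reading rows through the chunked accessors of …PcintMemUniformChunk so that every kernel
lookup is `O(√n)`:

* `rowPolyC`, `resHiC`, `resLoC`, `UPolyRowsC T WT numHi numLo K c lo cnt : Bool` (rows `lo … lo+cnt−1`), `UPolyAllC` (the per-row
  `Prop` the ranges establish), `upolyAllC_of_ranges`-style append lemma, and **`memGrowth_bounds_of_upolyC`**:
  `numLo(d)/(2d)^K ≤ μ_τ(ℤ^d) ≤ numHi(d)/(2d)^K` for every `d ≥ 6`, `d ≥ c`;
* level tables `LT : List (List (Option (List ℤ)))` of count polynomials (`lval`), `combineC`, `StageRowsC`, `InitRowsC` (`Bool`, row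
  ranges), the invariant `LevelOKC` and its propagation `levelOKC_init` / `levelOKC_step`, and the extraction
  **`cntP_eq_peval_of_levelOKC`**.

HONEST FRAMING: bookkeeping (the proofs are those of the `k = 4` files with chunked accessors).  No `sorry`; standard axioms.
Written by prim-pcint-2 gen 19 (prover-prim-pcint-2-g19-0), 2026-08-26.
-/

noncomputable section

namespace Summit.CriticalPhenomena.PercolationContinuityZ3.Theorems.Pcint

open Literature.Probability.Percolation Literature.Probability.LatticeModels PolyCert

variable {d : ℕ}
variable (P : List (Equiv.Perm (Fin 6))) (T : List (List (List ℕ × List ℕ)))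

/-! ### Polynomial certificates on chunked data -/

section Poly

/-- Chunked weight-polynomial accessor (default `[]`). [folklore] -/
def wgetC (WT : List (List (List ℤ))) (j : ℕ) : List ℤ := (cget WT j).getD []

/-- Successor indices of row `i` over the twelve letters (chunked). [folklore] -/
def baseIdxC (i : ℕ) : List (Option ℕ) := lettersSix.map (sistepC P T i)

/-- Successor indices of row `i` over the two letters of axis `5` (chunked). [folklore] -/
def freshIdxC (i : ℕ) : List (Option ℕ) := [sistepC P T i ((5 : Fin 6), true), sistepC P T i ((5 : Fin 6), false)]

/-- The row polynomial `base_i(W) + (X − 6)·fresh_i(W)`. [folklore] -/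
def rowPolyC (WT : List (List (List ℤ))) (i : ℕ) : List ℤ :=
  padd (psum (((baseIdxC P T i).reduceOption).map (wgetC WT)))
    (pmul [-6, 1] (psum (((freshIdxC P T i).reduceOption).map (wgetC WT))))

/-- Residual of the upper row inequality: `numHi·W_i − (2X)^K·row_i`. [folklore] -/
def resHiC (WT : List (List (List ℤ))) (numHi : List ℤ) (K i : ℕ) : List ℤ :=
  padd (pmul numHi (wgetC WT i)) (psmul (-1) (pmul (ppow twoX K) (rowPolyC P T WT i)))

/-- Residual of the lower row inequality: `(2X)^K·row_i − numLo·W_i`. [folklore] -/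
def resLoC (WT : List (List (List ℤ))) (numLo : List ℤ) (K i : ℕ) : List ℤ :=
  padd (pmul (ppow twoX K) (rowPolyC P T WT i)) (psmul (-1) (pmul numLo (wgetC WT i)))

/-- The polynomial certificate condition of one row (a `Bool`). [folklore] -/
def UPolyRowC (WT : List (List (List ℤ))) (numHi numLo : List ℤ) (K : ℕ) (c : ℤ) (i : ℕ) : Bool :=
  allNonneg (pshift (resHiC P T WT numHi K i) c) && allNonneg (pshift (resLoC P T WT numLo K i) c) &&
    posHead (pshift (wgetC WT i) c)

/-- The polynomial certificate of the rows `lo … lo+cnt−1`. [folklore] -/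
def UPolyRowsC (WT : List (List (List ℤ))) (numHi numLo : List ℤ) (K : ℕ) (c : ℤ) (lo cnt : ℕ) : Bool :=
  (List.range' lo cnt).all fun i => UPolyRowC P T WT numHi numLo K c i

/-- All rows `lo ≤ i < hi` pass (the `Prop` assembled from ranges). [folklore] -/
def UPolyAllC (WT : List (List (List ℤ))) (numHi numLo : List ℤ) (K : ℕ) (c : ℤ) (lo hi : ℕ) : Prop :=
  ∀ i < hi, lo ≤ i → UPolyRowC P T WT numHi numLo K c i = true

/-- A range of the `Bool` check gives the `Prop`. [folklore] -/
theorem upolyAllC_of_rows {WT : List (List (List ℤ))} {numHi numLo : List ℤ} {K : ℕ} {c : ℤ} {lo cnt : ℕ}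
    (h : UPolyRowsC P T WT numHi numLo K c lo cnt = true) : UPolyAllC P T WT numHi numLo K c lo (lo + cnt) :=
  fun i hi hlo => List.all_eq_true.1 h i (List.mem_range'_1.2 ⟨hlo, hi⟩)

/-- Ranges concatenate. [folklore] -/
theorem upolyAllC_append {WT : List (List (List ℤ))} {numHi numLo : List ℤ} {K : ℕ} {c : ℤ} {lo mid hi : ℕ}
    (h1 : UPolyAllC P T WT numHi numLo K c lo mid) (h2 : UPolyAllC P T WT numHi numLo K c mid hi) :
    UPolyAllC P T WT numHi numLo K c lo hi :=
  fun i hi' hlo => if him : i < mid then h1 i him hlo else h2 i hi' (Nat.le_of_not_lt him)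

/-- The row polynomial evaluates to the row sum of …PcintMemUniformGenBounds (`k = 5`) on `rowsOf T`. [folklore] -/
theorem peval_rowPolyC (hT : ChunksOK T = true) (WT : List (List (List ℤ))) (i : ℕ) (x : ℝ) :
    peval (rowPolyC P T WT i) x =
      baseSumK (k := 5) (rowsOf P T) (fun j => peval (wgetC WT j) x) i +
        (x - 6) * freshSumK (k := 5) (rowsOf P T) (fun j => peval (wgetC WT j) x) i := by
  rw [rowPolyC, peval_padd, peval_pmul, peval_psum, peval_psum, baseSum6_eq, freshSum6_eq, sum_map_optValR_eq,
    sum_map_optValR_eq, List.map_map, List.map_map]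
  have h6 : peval [-6, 1] x = x - 6 := by simp [peval]; ring
  rw [h6]
  have hb : lettersSix.map (sistep (rowsOf P T) i) = baseIdxC P T i := by
    unfold baseIdxC; exact List.map_congr_left fun a _ => sistep_rowsOf P T hT i a
  have hf : [((5 : Fin 6), true), ((5 : Fin 6), false)].map (sistep (rowsOf P T) i) = freshIdxC P T i := by
    simp [freshIdxC, sistep_rowsOf P T hT]
  rw [hb, hf]
  rfl

/-- **Soundness of the chunked polynomial certificate**: `numLo(d)/(2d)^K ≤ μ_τ(ℤ^d) ≤ numHi(d)/(2d)^K` for every `d ≥ 6` with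
`d ≥ c`, given structure, support, all rows passing and `numLo(d) > 0`. [cite: PonitzTittmann2000, §3] -/
theorem memGrowth_bounds_of_upolyC [NeZero d] {τ N : ℕ} (hτ : 2 ≤ τ) (hd : 6 ≤ d) (hT : ChunksOK T = true)
    (hN : (rowsOf P T).length = N) (hU : UStructK (k := 5) τ (rowsOf P T)) (hS : USuppK (k := 5) (rowsOf P T))
    {WT : List (List (List ℤ))} {numHi numLo : List ℤ} {K : ℕ} {c : ℤ}
    (hc : (c : ℝ) ≤ d) (hcert : UPolyAllC P T WT numHi numLo K c 0 N) (hlo : 0 < peval numLo d) :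
    peval numLo d / (2 * (d : ℝ)) ^ K ≤ MemoryTail.memGrowth d τ ∧
      MemoryTail.memGrowth d τ ≤ peval numHi d / (2 * (d : ℝ)) ^ K := by
  set w : ℕ → ℝ := fun j => peval (wgetC WT j) d with hw
  have h0 : 0 < (rowsOf P T).length := hU.1
  have hd' : (6 : ℝ) ≤ d := by exact_mod_cast hd
  have hpowpos : (0 : ℝ) < (2 * (d : ℝ)) ^ K := by positivity
  have hrow : ∀ i < (rowsOf P T).length,
      0 ≤ peval (resHiC P T WT numHi K i) d ∧ 0 ≤ peval (resLoC P T WT numLo K i) d ∧ 0 < w i := by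
    intro i hi
    rw [hN] at hi
    have h := hcert i hi (Nat.zero_le i)
    simp only [UPolyRowC, Bool.and_eq_true] at h
    exact ⟨peval_nonneg_of_shift h.1.1 hc, peval_nonneg_of_shift h.1.2 hc, peval_pos_of_shift h.2 hc⟩
  have hrowval : ∀ i, peval (rowPolyC P T WT i) d =
      baseSumK (k := 5) (rowsOf P T) w i + ((d : ℝ) - (5 + 1)) * freshSumK (k := 5) (rowsOf P T) w i := by
    intro i; rw [peval_rowPolyC P T hT, hw]; norm_num
  have hhi' : ∀ i < (rowsOf P T).length,
      baseSumK (k := 5) (rowsOf P T) w i + ((d : ℝ) - (5 + 1)) * freshSumK (k := 5) (rowsOf P T) w i ≤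
        peval numHi d / (2 * (d : ℝ)) ^ K * w i := by
    intro i hi
    have h := (hrow i hi).1
    rw [resHiC, peval_padd, peval_pmul, peval_psmul, peval_pmul, peval_ppow, peval_twoX, hrowval] at h
    push_cast at h
    rw [div_mul_eq_mul_div, le_div_iff₀ hpowpos]
    show _ * _ ≤ peval numHi ↑d * w i
    nlinarith
  have hlo' : ∀ i < (rowsOf P T).length,
      peval numLo d / (2 * (d : ℝ)) ^ K * w i ≤
        baseSumK (k := 5) (rowsOf P T) w i + ((d : ℝ) - (5 + 1)) * freshSumK (k := 5) (rowsOf P T) w i := by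
    intro i hi
    have h := (hrow i hi).2.1
    rw [resLoC, peval_padd, peval_pmul, peval_psmul, peval_pmul, peval_ppow, peval_twoX, hrowval] at h
    push_cast at h
    rw [div_mul_eq_mul_div, div_le_iff₀ hpowpos]
    show peval numLo ↑d * w i ≤ _ * _
    nlinarith
  have hwpos : ∀ i < (rowsOf P T).length, 0 < w i := fun i hi => (hrow i hi).2.2
  have hhiPos : 0 < peval numHi d := by
    have h1 := hhi' 0 h0
    have h2 := hlo' 0 h0
    have hw0 := hwpos 0 h0
    have : 0 < peval numLo d / (2 * (d : ℝ)) ^ K * w 0 := mul_pos (div_pos hlo hpowpos) hw0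
    have h3 : 0 < peval numHi d / (2 * (d : ℝ)) ^ K * w 0 := by linarith
    have h4 : 0 < peval numHi d / (2 * (d : ℝ)) ^ K := pos_of_mul_pos_left h3 hw0.le
    exact (div_pos_iff_of_pos_right hpowpos).1 h4
  exact ⟨le_memGrowth_of_ucertK hτ hd hU hS w _ (div_pos hlo hpowpos) hwpos hlo',
    memGrowth_le_of_ucertK hτ hd hU hS w _ (div_pos hhiPos hpowpos) hwpos hhi'⟩

end Poly

/-! ### Exact counts by stages on chunked level tables -/

section Stages

/-- Chunked level-table accessor: `none` = row not certified at this level. [folklore] -/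
def lval (LT : List (List (Option (List ℤ)))) (i : ℕ) : Option (List ℤ) := (cget LT i).getD none

/-- Beyond the stored entries every row is uncertified. [folklore] -/
theorem lval_eq_none_of_le {LT : List (List (Option (List ℤ)))} (hL : ChunksOK LT = true) {i : ℕ}
    (hi : (LT.map List.length).sum ≤ i) : lval LT i = none := by
  unfold lval
  rw [← getElem?_flatten_eq_cget LT hL i, List.getElem?_eq_none (by rw [List.length_flatten]; exact hi)]
  rfl

/-- Recompute the level-`k+1` polynomial of row `i` from a level-`k` table (all successors must be certified). [folklore] -/
def combineC (prev : List (List (Option (List ℤ)))) (i : ℕ) : Option (List ℤ) :=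
  if ((baseIdxC P T i).reduceOption ++ (freshIdxC P T i).reduceOption).all (fun j => (lval prev j).isSome) then
    some (padd (psum (((baseIdxC P T i).reduceOption).map fun j => (lval prev j).getD []))
      (pmul [-6, 1] (psum (((freshIdxC P T i).reduceOption).map fun j => (lval prev j).getD []))))
  else none

/-- Stage check on the rows `lo … lo+cnt−1`: every certified entry of `next` is recomputed from `prev`. [folklore] -/
def StageRowsC (prev next : List (List (Option (List ℤ)))) (lo cnt : ℕ) : Bool :=
  (List.range' lo cnt).all fun i =>
    match lval next i with
    | none => true
    | some p => decide (combineC P T prev i = some p)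

/-- Initial check on the rows `lo … lo+cnt−1` for the predicate "age `j` present". [folklore] -/
def InitRowsC (j : ℕ) (LT : List (List (Option (List ℤ)))) (lo cnt : ℕ) : Bool :=
  (List.range' lo cnt).all fun i =>
    match lval LT i with
    | none => true
    | some p => decide (p = if HasAge j (sstC T i) then [1] else [])

/-- The count of the uniform index automaton of `rowsOf T` with final predicate "age `j` present", as a real. [folklore] -/
def ucntR (d j i k : ℕ) : ℝ := (cntP (uistepK 5 (rowsOf P T) d) (fun i => HasAge j (sstOf (rowsOf P T) i)) i k : ℝ)

/-- Correctness of a level-`k` table at dimension `d` on the rows `lo ≤ i < hi`: every certified entry evaluates to the count.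
[folklore] -/
def LevelRowsOKC (d j k : ℕ) (LT : List (List (Option (List ℤ)))) (lo hi : ℕ) : Prop :=
  ∀ i < hi, lo ≤ i → ∀ p, lval LT i = some p → peval p d = ucntR P T d j i k

/-- Correctness of a level-`k` table on every row. [folklore] -/
def LevelOKC (d j k : ℕ) (LT : List (List (Option (List ℤ)))) : Prop :=
  ∀ i p, lval LT i = some p → peval p d = ucntR P T d j i k

/-- Ranges concatenate. [folklore] -/
theorem levelRowsOKC_append {d j k : ℕ} {LT : List (List (Option (List ℤ)))} {lo mid hi : ℕ}
    (h1 : LevelRowsOKC P T d j k LT lo mid) (h2 : LevelRowsOKC P T d j k LT mid hi) : LevelRowsOKC P T d j k LT lo hi :=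
  fun i hi' hlo => if him : i < mid then h1 i him hlo else h2 i hi' (Nat.le_of_not_lt him)

/-- A full range plus the table length give correctness everywhere. [folklore] -/
theorem levelOKC_of_range {d j k : ℕ} {LT : List (List (Option (List ℤ)))} {N : ℕ} (hL : ChunksOK LT = true)
    (hlen : (LT.map List.length).sum = N) (h : LevelRowsOKC P T d j k LT 0 N) : LevelOKC P T d j k LT := by
  intro i p hp
  by_cases hi : i < N
  · exact h i hi (Nat.zero_le i) p hp
  · rw [lval_eq_none_of_le hL (by rw [hlen]; omega)] at hp
    exact absurd hp (by simp)

/-- **Initial ranges are correct at level `0`.** [folklore] -/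
theorem initRows_sound (hT : ChunksOK T = true) {d j : ℕ} {LT : List (List (Option (List ℤ)))} {lo cnt : ℕ}
    (h : InitRowsC T j LT lo cnt = true) : LevelRowsOKC P T d j 0 LT lo (lo + cnt) := by
  intro i hi hlo p hp
  have hrow := List.all_eq_true.1 h i (List.mem_range'_1.2 ⟨hlo, hi⟩)
  rw [hp] at hrow
  simp only [decide_eq_true_eq] at hrow
  rw [hrow]
  simp only [ucntR, cntP, sstOf_rowsOf P T hT]
  by_cases hP : HasAge j (sstC T i) <;> simp [hP, peval]

/-- **Stage propagation on a range**: a correct level-`k` table and a passing stage check give a correct level-`k+1` table on the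
range (`d ≥ 6`). [folklore] -/
theorem stageRows_sound (hT : ChunksOK T = true) {d : ℕ} (hd : 6 ≤ d) {j k : ℕ} {prev next : List (List (Option (List ℤ)))}
    (hprev : LevelOKC P T d j k prev) {lo cnt : ℕ} (h : StageRowsC P T prev next lo cnt = true) :
    LevelRowsOKC P T d j (k + 1) next lo (lo + cnt) := by
  intro i hi hlo p hp
  have hrow := List.all_eq_true.1 h i (List.mem_range'_1.2 ⟨hlo, hi⟩)
  rw [hp] at hrow
  simp only [decide_eq_true_eq, combineC] at hrow
  split_ifs at hrow with hall
  simp only [Option.some.injEq] at hrow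
  rw [← hrow, peval_padd, peval_pmul, peval_psum, peval_psum, List.map_map, List.map_map]
  have h6 : peval [-6, 1] (d : ℝ) = (d : ℝ) - (5 + 1) := by simp [peval]; ring
  unfold ucntR
  rw [h6, cntP_uistepK_succ_real (rowsOf P T) hd _ i k, baseSum6_eq, freshSum6_eq, sum_map_optValR_eq,
    sum_map_optValR_eq]
  have hb : lettersSix.map (sistep (rowsOf P T) i) = baseIdxC P T i := by
    unfold baseIdxC; exact List.map_congr_left fun a _ => sistep_rowsOf P T hT i a
  have hf : [((5 : Fin 6), true), ((5 : Fin 6), false)].map (sistep (rowsOf P T) i) = freshIdxC P T i := by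
    simp [freshIdxC, sistep_rowsOf P T hT]
  have hval : ∀ m ∈ (baseIdxC P T i).reduceOption ++ (freshIdxC P T i).reduceOption,
      peval ((lval prev m).getD []) d = ucntR P T d j m k := by
    intro m hm
    have hs := List.all_eq_true.1 hall m hm
    cases hlk : lval prev m with
    | none => rw [hlk] at hs; simp at hs
    | some q => simp only [Option.getD_some]; exact hprev m q hlk
  unfold ucntR at hval
  rw [hb, hf]
  push_cast
  congr 1
  · congr 1
    exact List.map_congr_left fun m hm => hval m (List.mem_append_left _ hm)
  · congr 1
    congr 1
    exact List.map_congr_left fun m hm => hval m (List.mem_append_right _ hm)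

/-- **Extraction**: a certified entry of a correct level-`k` table IS the count (for `d ≥ 6`, row `0`: `cntP (mstep τ) (HasAge j) ∅ k`
by …MemUniformGen). [folklore] -/
theorem cntP_eq_peval_of_levelOKC {d : ℕ} (hd : 6 ≤ d) {τ j k : ℕ} (hU : UStructK (k := 5) τ (rowsOf P T))
    (hS : USuppK (k := 5) (rowsOf P T)) {LT : List (List (Option (List ℤ)))} (hL : LevelOKC P T d j k LT) {p : List ℤ}
    (hp : lval LT 0 = some p) : (cntP (mstep τ) (HasAge j) (∅ : MState d) k : ℝ) = peval p d := by
  rw [cntP_mstep_eq_cntP_uistepK (k := 5) hd hU hS j k]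
  exact (hL 0 p hp).symm

end Stages

end Summit.CriticalPhenomena.PercolationContinuityZ3.Theorems.Pcint
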